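import Summits.Ventures.CertifiedArithmetic.LowPrec.SRKahanFormats
import HarnessLib

/-!
# Stochastic rounding into a finite format, XXXII: the exact forward law of compensated summation

HONEST FRAMING: certified error envelopes and provably optimal rounding/accumulation schemes for
low-precision formats under stated cost models; every table by two implementations; no hardware or
vendor claims.

Venture CertifiedArithmetic / lowprec, SR slice (gen8, part 2). The expectation operator
`kahanExp F x n g s c` of file XXIX (Kahan's compensated loop, every operation a saturating SR)
is an expectation over `16^n` rounding branches, and the sure predicates `NoSatK` … of files
XXIX–XXX are decided by the same exponential enumeration. But the state `(s, c)` lies in `F × F`,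
so its LAW has at most `|F|²` atoms and is pushed FORWARD summand by summand at polynomial cost.

* `massSum`, `insertMass`, `mergeMass` — finitely supported masses as merged association lists
  (`massSum_mergeMass`: merging preserves every integral; `forall_keys_mergeMass`: same keys).
* `twoPt F e`, `stepMass F x q` — the two-point law of one SR step and the sixteen atoms of one
  Kahan step from the atom `q = ((s, c), p)` (`step_eq_massSum`, `massSum_stepMass`).
* `kahanLaw F x n l` — the law after `n` summands from the initial mass `l`;
  **`kahanExp_eq_massSum`**: `kahanExp F x n g s c = Σ_{atoms} p · g(s', c')` (the DP is exact);
  **`kahanVar_eq_varLaw`**: the accumulated small-operation variance by the same pass;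
  **`noSatK_iff_lawB`**: the sure path predicates are decided on the atoms of the forward laws
  (`16 · #atoms` tests per summand, not `16^n`); `kahanLaw_succ` / `smallOpsLawB_succ`: one
  more summand = one merged push of the previous law (staging of long passes).
* Kernel instances (`decide +kernel` on the DP, each pass its own declaration): **E3M2, ten
  summands `7/4`** (`16^10 ≈ 10^12` branches, ≤ 11 atoms): `NoSatK`, `E[s − c] = 35/2` exactly,
  `Var = 188121 / 2^21 ≈ 0.090`, `P(exact) = 4211 / 8192`; **summands `4`**: fourteen give
  `(s, c) = (28, −28)` SURELY (`s − c = 56 = 2 · max F`, exact), a fifteenth saturates the y-op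
  (`NoSatK` fails, `E[s − c] = 56 ≠ 60`); **twenty `1`s**: `(20, 0)` surely; **E2M1, `1`s**:
  eleven unbiased (`Var = 1`, never exact), at twelve `NoSatK` fails, `E[s − c] = 23/2`; **E2M3,
  twenty alternating `7/4, −5/4`**: `(5, 0)` surely — except for the new `4`s threshold, a THIRD
  implementation of rows of `certs/sr/gen8/kahan/KAHANFAM_*` (A, B run outside the kernel).
-/

namespace Summit.Ventures.CertifiedArithmetic.LowPrec.SR

open Literature.ComputerArithmetic.ConnollyHighamMary2021
open Literature.ComputerArithmetic.FloatingPoint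
open Literature.ComputerArithmetic.FloatingPoint.MiniFloat

/-! ### Finitely supported masses as association lists (generic keys) -/

section Mass

variable {K : Type*} [Field K] {α : Type*}

/-- `massSum l φ = Σ_{(a, p) ∈ l} p · φ a`. -/
def massSum (l : List (α × K)) (φ : α → K) : K := (l.map fun q => q.2 * φ q.1).sum

/-- `massSum` of a cons. -/
theorem massSum_cons (q : α × K) (l : List (α × K)) (φ : α → K) :
    massSum (q :: l) φ = q.2 * φ q.1 + massSum l φ := by simp [massSum]

/-- `massSum` of a singleton unit mass. -/
theorem massSum_single (a : α) (φ : α → K) : massSum [(a, (1 : K))] φ = φ a := by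
  simp [massSum]

/-- `massSum` is additive over concatenation. -/
theorem massSum_append (l l' : List (α × K)) (φ : α → K) :
    massSum (l ++ l') φ = massSum l φ + massSum l' φ := by simp [massSum, List.sum_append]

/-- `massSum` is additive in the integrand. -/
theorem massSum_add (l : List (α × K)) (φ ψ : α → K) :
    massSum l (fun a => φ a + ψ a) = massSum l φ + massSum l ψ := by
  induction l with | nil => simp [massSum] | cons q l ih => simp only [massSum_cons, ih]; ring

/-- `massSum` of a `flatMap` is the sum of the `massSum`s. -/
theorem massSum_flatMap {β : Type*} (L : List β) (f : β → List (α × K)) (φ : α → K) :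
    massSum (L.flatMap f) φ = (L.map fun b => massSum (f b) φ).sum := by
  induction L with
  | nil => simp [massSum] | cons b L ih => rw [List.flatMap_cons, massSum_append, ih]; simp

variable [DecidableEq α]

/-- Insert an atom, adding its mass to an existing atom with the same key. -/
def insertMass : α × K → List (α × K) → List (α × K)
  | q, [] => [q]
  | (a, p), (a', p') :: l => if a = a' then (a', p' + p) :: l else (a', p') :: insertMass (a, p) l

/-- Merge atoms with equal keys. -/
def mergeMass (l : List (α × K)) : List (α × K) := l.foldr insertMass []

/-- `insertMass` preserves every `massSum`. -/
theorem massSum_insertMass (q : α × K) :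
    ∀ (l : List (α × K)) (φ : α → K),
      massSum (insertMass q l) φ = q.2 * φ q.1 + massSum l φ
  | [], φ => by simp [insertMass, massSum]
  | (a', p') :: l, φ => by
      obtain ⟨a, p⟩ := q
      simp only [insertMass]
      split_ifs with h
      · subst h; simp only [massSum_cons]; ring
      · rw [massSum_cons, massSum_cons, massSum_insertMass (a, p) l φ]; ring

/-- Merging preserves every `massSum`. -/
theorem massSum_mergeMass (l : List (α × K)) (φ : α → K) :
    massSum (mergeMass l) φ = massSum l φ := by
  induction l with
  | nil => rfl
  | cons q l ih =>
      simp only [mergeMass, List.foldr_cons] at ih ⊢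
      rw [massSum_insertMass, ih, massSum_cons]

/-- Keys of `insertMass q l`: the key of `q` and the keys of `l`. -/
theorem forall_keys_insertMass (P : α → Prop) (q : α × K) :
    ∀ l : List (α × K), (∀ r ∈ insertMass q l, P r.1) ↔ P q.1 ∧ ∀ r ∈ l, P r.1
  | [] => by simp [insertMass]
  | (a', p') :: l => by
      obtain ⟨a, p⟩ := q
      simp only [insertMass]
      split_ifs with h
      · subst h; simp only [List.forall_mem_cons]; tauto
      · simp only [List.forall_mem_cons, forall_keys_insertMass P (a, p) l]; tauto

/-- `mergeMass` has the same keys: a property of keys holds on all atoms of `mergeMass l` iff on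
all atoms of `l`. -/
theorem forall_keys_mergeMass (P : α → Prop) (l : List (α × K)) :
    (∀ r ∈ mergeMass l, P r.1) ↔ ∀ r ∈ l, P r.1 := by
  induction l with
  | nil => simp [mergeMass]
  | cons q l ih =>
      simp only [mergeMass, List.foldr_cons] at ih ⊢
      rw [forall_keys_insertMass, ih, List.forall_mem_cons]

end Mass

variable {K : Type*} [Field K] [LinearOrder K]

/-! ### One SR step and one Kahan step as masses -/

/-- The two-point law `{(⌈ē⌉, p↑), (⌊ē⌋, 1 − p↑)}` of one saturating SR step at `e`. -/
def twoPt (F : Finset K) (e : K) : List (K × K) := [(up F e, pUp F e), (dn F e, 1 - pUp F e)]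

/-- `step` is the integral against `twoPt`. -/
theorem step_eq_massSum (F : Finset K) (e : K) (f : K → K) :
    step F e f = massSum (twoPt F e) f := by
  simp [step, twoPt, massSum]

/-- The (at most sixteen) atoms of ONE Kahan step with summand `x` from the weighted state
`q = ((s, c), p)`: keys `(t, c')`, masses `p · p_y · p_t · p_d · p_c`. -/
def stepMass (F : Finset K) (x : K) (q : (K × K) × K) : List ((K × K) × K) :=
  (twoPt F (x - q.1.2)).flatMap fun yq => (twoPt F (q.1.1 + yq.1)).flatMap fun tq =>
    (twoPt F (tq.1 - q.1.1)).flatMap fun dq => (twoPt F (dq.1 - yq.1)).map fun cq =>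
      ((tq.1, cq.1), q.2 * (yq.2 * (tq.2 * (dq.2 * cq.2))))

/-- **One Kahan step as a mass**: `Σ_{atoms of stepMass} = p · kahanStep`. -/
theorem massSum_stepMass (F : Finset K) (x : K) (q : (K × K) × K) (φ : K × K → K) :
    massSum (stepMass F x q) φ = q.2 * kahanStep F x q.1.1 q.1.2 (fun t c' => φ (t, c')) := by
  simp only [stepMass, twoPt, kahanStep, kahanInner, step, massSum, List.flatMap_cons,
    List.flatMap_nil, List.map_cons, List.map_nil, List.append_nil, List.sum_cons, List.sum_nil,
    List.map_append, List.sum_append]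
  ring

/-! ### The forward law of the state `(s, c)` -/

/-- **The forward law** `kahanLaw F x n l`: the mass `l` on states `(s, c)` pushed through the
summands `x 0, …, x (n−1)` (each atom ↦ its sixteen successors, merged; `O(16 · A²)` list
operations per summand, `A ≤ |F|²` atoms). -/
def kahanLaw (F : Finset K) : (ℕ → K) → ℕ → List ((K × K) × K) → List ((K × K) × K)
  | _, 0, l => l
  | x, n + 1, l => kahanLaw F (fun i => x (i + 1)) n (mergeMass (l.flatMap (stepMass F (x 0))))

/-- **The DP is exact**: `φ` against the pushed law = the expectation `kahanExp … φ` against `l`. -/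
theorem massSum_kahanLaw (F : Finset K) :
    ∀ (n : ℕ) (x : ℕ → K) (l : List ((K × K) × K)) (φ : K × K → K),
      massSum (kahanLaw F x n l) φ
        = massSum l fun a => kahanExp F x n (fun s c => φ (s, c)) a.1 a.2
  | 0, x, l, φ => by simp [kahanLaw, kahanExp]
  | n + 1, x, l, φ => by
      rw [kahanLaw, massSum_kahanLaw F n, massSum_mergeMass, massSum_flatMap]
      simp only [massSum_stepMass, kahanExp]
      rfl

/-- **`kahanExp` by the forward law**: `E g(s_n, c_n) = Σ_{atoms ((s', c'), p)} p · g s' c'`. -/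
theorem kahanExp_eq_massSum (F : Finset K) (x : ℕ → K) (n : ℕ) (g : K → K → K) (s c : K) :
    kahanExp F x n g s c = massSum (kahanLaw F x n [((s, c), 1)]) fun a => g a.1 a.2 := by
  rw [massSum_kahanLaw, massSum_single]

/-- **One more summand** = one merged push of the previous law (staging of long passes). -/
theorem kahanLaw_succ (F : Finset K) :
    ∀ (n : ℕ) (x : ℕ → K) (l : List ((K × K) × K)),
      kahanLaw F x (n + 1) l = mergeMass ((kahanLaw F x n l).flatMap (stepMass F (x n)))
  | 0, _, _ => rfl
  | n + 1, x, l => by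
      show kahanLaw F (fun i => x (i + 1)) (n + 1) _ = _
      rw [kahanLaw_succ F n]; rfl

/-- The small-operation variance along the forward pass: `Σ_k Σ_{atoms of law_k} p · localVar`. -/
def varLaw (F : Finset K) : (ℕ → K) → ℕ → List ((K × K) × K) → K
  | _, 0, _ => 0
  | x, n + 1, l => massSum l (fun a => localVar F (x 0) a.1 a.2)
      + varLaw F (fun i => x (i + 1)) n (mergeMass (l.flatMap (stepMass F (x 0))))

/-- The variance pass is exact (general initial mass). -/
theorem varLaw_eq (F : Finset K) :
    ∀ (n : ℕ) (x : ℕ → K) (l : List ((K × K) × K)),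
      varLaw F x n l = massSum l fun a => kahanVar F x n a.1 a.2
  | 0, x, l => by simp [varLaw, kahanVar, massSum]
  | n + 1, x, l => by
      rw [varLaw, varLaw_eq F n, massSum_mergeMass, massSum_flatMap]
      simp only [massSum_stepMass, kahanVar, massSum_add]
      rfl

/-- **`kahanVar` by the forward law.** -/
theorem kahanVar_eq_varLaw (F : Finset K) (x : ℕ → K) (n : ℕ) (s c : K) :
    kahanVar F x n s c = varLaw F x n [((s, c), 1)] := by rw [varLaw_eq, massSum_single]

/-! ### Sure path predicates decided on the atoms -/

/-- The successors in one Kahan step are the keys of `stepMass`: `StepAll P` iff `P` holds at every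
atom. -/
theorem stepAll_iff_stepMass (F : Finset K) (x : K) (q : (K × K) × K) (P : K → K → Prop) :
    StepAll F x q.1.1 q.1.2 P ↔ ∀ r ∈ stepMass F x q, P r.1.1 r.1.2 := by
  simp [StepAll, OnBoth, stepMass, twoPt, and_assoc]

section SmallOps

variable (F : Finset K) (Py Pd Pc : K → Prop) [DecidablePred Py] [DecidablePred Pd]
  [DecidablePred Pc]

/-- Boolean evaluator of `StepSmall` (file XXX's `stepSmallB`) computes it. -/
theorem stepSmallB_iff (x s c : K) :
    stepSmallB F Py Pd Pc x s c = true ↔ StepSmall F Py Pd Pc x s c := by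
  simp [stepSmallB, StepSmall, onBothB, OnBoth, Bool.and_eq_true]

/-- `SmallOps` along the forward pass: the one-step test at every atom of every intermediate law. -/
def smallOpsLawB : (ℕ → K) → ℕ → List ((K × K) × K) → Bool
  | _, 0, _ => true
  | x, n + 1, l => (l.all fun a => stepSmallB F Py Pd Pc (x 0) a.1.1 a.1.2)
      && smallOpsLawB (fun i => x (i + 1)) n (mergeMass (l.flatMap (stepMass F (x 0))))

/-- **The sure predicates by the DP** (general initial mass): `smallOpsLawB = true` iff `SmallOps`
holds from every atom. -/
theorem smallOpsLawB_iff : ∀ (n : ℕ) (x : ℕ → K) (l : List ((K × K) × K)),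
      smallOpsLawB F Py Pd Pc x n l = true ↔ ∀ a ∈ l, SmallOps F Py Pd Pc x n a.1.1 a.1.2
  | 0, x, l => by simp [smallOpsLawB, SmallOps]
  | n + 1, x, l => by
      rw [smallOpsLawB, Bool.and_eq_true, smallOpsLawB_iff n, forall_keys_mergeMass
        (fun k : K × K => SmallOps F Py Pd Pc (fun i => x (i + 1)) n k.1 k.2), List.all_eq_true]
      simp only [SmallOps, stepSmallB_iff, List.forall_mem_flatMap, ← stepAll_iff_stepMass]
      exact ⟨fun h a ha => ⟨h.1 a ha, h.2 a ha⟩, fun h => ⟨fun a ha => (h a ha).1,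
        fun a ha => (h a ha).2⟩⟩

/-- One more summand for the sure predicates: the previous verdict and the one-step test on the
previous law. -/
theorem smallOpsLawB_succ : ∀ (n : ℕ) (x : ℕ → K) (l : List ((K × K) × K)),
      smallOpsLawB F Py Pd Pc x (n + 1) l = (smallOpsLawB F Py Pd Pc x n l
        && (kahanLaw F x n l).all fun a => stepSmallB F Py Pd Pc (x n) a.1.1 a.1.2)
  | 0, x, l => by simp [smallOpsLawB, kahanLaw]
  | n + 1, x, l => by
      show (_ && smallOpsLawB F Py Pd Pc (fun i => x (i + 1)) (n + 1) _) = _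
      rw [smallOpsLawB_succ n, ← Bool.and_assoc]; rfl

/-- **`SmallOps` from one state by the DP.** -/
theorem smallOps_iff_lawB (x : ℕ → K) (n : ℕ) (s c : K) :
    SmallOps F Py Pd Pc x n s c ↔ smallOpsLawB F Py Pd Pc x n [((s, c), 1)] = true := by
  rw [smallOpsLawB_iff]; simp

end SmallOps

/-- **`NoSatK` by the DP** (`16 · #atoms` hull tests per summand instead of `16^n`). -/
theorem noSatK_iff_lawB (F : Finset K) (x : ℕ → K) (n : ℕ) (s c : K) :
    NoSatK F x n s c ↔ smallOpsLawB F (InHull F) (InHull F) (InHull F) x n [((s, c), 1)] = true :=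
  smallOps_iff_lawB F _ _ _ x n s c

/-! ### Statistics of the law, read in one pass -/

/-- Mean of `s − c`, mean square deviation of `s − c` from `tot`, `P(s − c = tot)` and the mean
of `s`, all read off ONE mass `l`. -/
def massStats (l : List ((K × K) × K)) (tot : K) : K × K × K × K :=
  (massSum l fun a => a.1 - a.2, massSum l fun a => (a.1 - a.2 - tot) ^ 2,
    massSum l fun a => if a.1 - a.2 = tot then 1 else 0, massSum l fun a => a.1)

/-- The four statistics of the law of `(s_n, c_n)` from `(s, c)` (one evaluation of the DP). -/
def lawStats (F : Finset K) (x : ℕ → K) (n : ℕ) (s c tot : K) : K × K × K × K :=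
  massStats (kahanLaw F x n [((s, c), 1)]) tot

/-- `lawStats` ARE the four expectations `E[s − c]`, `E[(s − c − tot)²]`, `P(s − c = tot)`,
`E s` of the compensated process. -/
theorem lawStats_eq (F : Finset K) (x : ℕ → K) (n : ℕ) (s c tot : K) :
    lawStats F x n s c tot
      = (kahanExp F x n (fun s c => s - c) s c, kahanExp F x n (fun s c => (s - c - tot) ^ 2) s c,
          kahanExp F x n (fun s c => if s - c = tot then 1 else 0) s c,
          kahanExp F x n (fun s _ => s) s c) := by
  simp only [lawStats, massStats, kahanExp_eq_massSum]

/-! ### Kernel instances (FP6 and FP4; every heavy DP pass is its own declaration) -/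

namespace KahanLaw

open FP4 (e2m1)
open Formats (e3m2 e2m3)

/-- The unit mass at `(0, 0)`. -/
abbrev init : List ((ℚ × ℚ) × ℚ) := [((0, 0), 1)]

set_option maxHeartbeats 2000000 in
/-- DP pass (E3M2, ten summands `7/4`): no small operation saturates on any atom. -/
theorem e3m2_sevenQuarters_lawB :
    smallOpsLawB e3m2 (InHull e3m2) (InHull e3m2) (InHull e3m2) (fun _ => 7 / 4) 10 init
      = true := by
  decide +kernel

set_option maxHeartbeats 2000000 in
/-- DP pass (E3M2, ten summands `7/4`): the four statistics of the law (≤ 11 atoms). -/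
theorem e3m2_sevenQuarters_stats : lawStats e3m2 (fun _ => 7 / 4) 10 0 0 (35 / 2)
    = (35 / 2, 188121 / 2097152, 4211 / 8192, 35 / 2) := by
  decide +kernel

/-- **E3M2, ten summands `7/4` from `(0, 0)` (`16^10 ≈ 10^12` branches, two DP passes).** No
small operation saturates, so `E[s − c] = 35/2` EXACTLY (file XXIX); `Var(s − c) = 188121 / 2^21
(≈ 0.090)`; `P(s − c = 35/2) = 4211 / 8192`; `E s = 35/2`. Row `const:7/4, n = 10` of
`KAHANFAM_e3m2` — its third implementation, inside the kernel. -/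
theorem e3m2_ten_sevenQuarters :
    NoSatK e3m2 (fun _ => 7 / 4) 10 0 0
    ∧ kahanExp e3m2 (fun _ => 7 / 4) 10 (fun s c => s - c) 0 0 = 35 / 2
    ∧ kahanExp e3m2 (fun _ => 7 / 4) 10 (fun s c => (s - c - 35 / 2) ^ 2) 0 0 = 188121 / 2097152
    ∧ kahanExp e3m2 (fun _ => 7 / 4) 10 (fun s c => if s - c = 35 / 2 then 1 else 0) 0 0
        = 4211 / 8192
    ∧ kahanExp e3m2 (fun _ => 7 / 4) 10 (fun s _ => s) 0 0 = 35 / 2 := by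
  have h := e3m2_sevenQuarters_stats
  rw [lawStats_eq, Prod.mk.injEq, Prod.mk.injEq, Prod.mk.injEq] at h
  exact ⟨(noSatK_iff_lawB _ _ _ _ _).2 e3m2_sevenQuarters_lawB, h⟩

/-- DP pass (E3M2, fourteen summands `4`): the law is the POINT MASS at `(28, −28)`. -/
theorem e3m2_fours_law : kahanLaw e3m2 (fun _ => 4) 14 init = [((28, -28), 1)] := by
  decide +kernel

/-- DP pass: and no small operation saturates on the way. -/
theorem e3m2_fours_lawB :
    smallOpsLawB e3m2 (InHull e3m2) (InHull e3m2) (InHull e3m2) (fun _ => 4) 14 init = true := by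
  decide +kernel

/-- **E3M2, summands `4`: `(s, c)` represents sums up to `2 · max F` exactly.** Fourteen summands:
no small operation saturates and `(s, c) = (28, −28)` SURELY (`s − c = 56`: `s` saturated, `c`
carries the excess); a fifteenth saturates the y-op (`4 − (−28) = 32 > 28`): `NoSatK` fails and
`E[s − c] = 56 ≠ 60` (STAGED: one step from the certified law at fourteen, `kahanLaw_succ`). -/
theorem e3m2_fours :
    NoSatK e3m2 (fun _ => 4) 14 0 0
    ∧ kahanExp e3m2 (fun _ => 4) 14 (fun s c => if s = 28 ∧ c = -28 then 1 else 0) 0 0 = 1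
    ∧ ¬ NoSatK e3m2 (fun _ => 4) 15 0 0
    ∧ kahanExp e3m2 (fun _ => 4) 15 (fun s c => s - c) 0 0 = 56 := by
  refine ⟨(noSatK_iff_lawB _ _ _ _ _).2 e3m2_fours_lawB, ?_, fun h => ?_, ?_⟩
  · rw [kahanExp_eq_massSum, ← init, e3m2_fours_law]; decide +kernel
  · have h' := (noSatK_iff_lawB _ _ _ _ _).1 h
    rw [← init, smallOpsLawB_succ, e3m2_fours_law] at h'
    exact absurd h' (by decide +kernel)
  · rw [kahanExp_eq_massSum, ← init, kahanLaw_succ, e3m2_fours_law]; decide +kernel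

/-- **E3M2, twenty summands `1`: the law is the point mass at `(20, 0)`** (exact surely; plain
recursive SR of sixteen ones already saturates with probability `1/1024`, file XIX `cornerUp_15`,
and has mean square error `2601/256 ≈ 10.2` at `n = 16`, `≈ 17.9` at `n = 20`: row `const:1`). -/
theorem e3m2_twenty_ones : kahanLaw e3m2 (fun _ => 1) 20 init = [((20, 0), 1)]
    ∧ kahanExp e3m2 (fun _ => 1) 20 (fun s c => if s - c = 20 then 1 else 0) 0 0 = 1 := by
  have h : kahanLaw e3m2 (fun _ => 1) 20 init = [((20, 0), 1)] := by decide +kernel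
  exact ⟨h, by rw [kahanExp_eq_massSum, ← init, h]; decide +kernel⟩

/-- **E2M1 (FP4), summands `1`: eleven are compensated without bias, twelve are not.** `n = 11`:
`NoSatK`, `E[s − c] = 11`, but `P(s − c = 11) = 0`, `Var = 1` (`s = 6` surely, `−5 ∉ F`:
`c ∈ {−4, −6}`); `n = 12`: the y-op `1 − (−6) = 7 > 6` saturates, `NoSatK` FAILS,
`E[s − c] = 23/2 ≠ 12` (plain recursive SR of ones in FP4 is biased from `n = 7`). -/
theorem e2m1_ones_eleven_twelve :
    NoSatK e2m1 (fun _ => 1) 11 0 0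
    ∧ kahanExp e2m1 (fun _ => 1) 11 (fun s c => s - c) 0 0 = 11
    ∧ kahanExp e2m1 (fun _ => 1) 11 (fun s c => (s - c - 11) ^ 2) 0 0 = 1
    ∧ kahanExp e2m1 (fun _ => 1) 11 (fun s c => if s - c = 11 then 1 else 0) 0 0 = 0
    ∧ ¬ NoSatK e2m1 (fun _ => 1) 12 0 0
    ∧ kahanExp e2m1 (fun _ => 1) 12 (fun s c => s - c) 0 0 = 23 / 2 := by
  have h : lawStats e2m1 (fun _ => 1) 11 0 0 11 = (11, 1, 0, 6) := by decide +kernel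
  rw [lawStats_eq, Prod.mk.injEq, Prod.mk.injEq, Prod.mk.injEq] at h
  refine ⟨(noSatK_iff_lawB _ _ _ _ _).2 (by decide +kernel), h.1, h.2.1, h.2.2.1, fun hn => ?_,
    ?_⟩
  · exact absurd ((noSatK_iff_lawB _ _ _ _ _).1 hn) (by decide +kernel)
  · rw [kahanExp_eq_massSum]; decide +kernel

/-- Alternating E2M3 test data `7/4, −5/4, 7/4, −5/4, …`. -/
def alt (i : ℕ) : ℚ := if i % 2 = 0 then 7 / 4 else -5 / 4

/-- **E2M3, twenty alternating summands `7/4, −5/4` (sum `5`): the law is the point mass at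
`(5, 0)`** (row `alt:7/4,-5/4, n = 20` of `KAHANFAM_e2m3`; plain recursive SR has variance `5/16`
there). -/
theorem e2m3_twenty_alternating : kahanLaw e2m3 alt 20 init = [((5, 0), 1)] := by
  decide +kernel

/-- The `NoSatK` thresholds over the formats' value sets `valueSet E3M2 / E2M1` (file III). -/
theorem valueSet_thresholds :
    (NoSatK (valueSet Format.E3M2) (fun _ => 4) 14 0 0
      ∧ ¬ NoSatK (valueSet Format.E3M2) (fun _ => 4) 15 0 0)
    ∧ NoSatK (valueSet Format.E2M1) (fun _ => 1) 11 0 0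
    ∧ ¬ NoSatK (valueSet Format.E2M1) (fun _ => 1) 12 0 0 := by
  rw [← e3m2_eq_valueSet, ← e2m1_eq_valueSet]
  exact ⟨⟨e3m2_fours.1, e3m2_fours.2.2.1⟩, e2m1_ones_eleven_twelve.1,
    e2m1_ones_eleven_twelve.2.2.2.2.1⟩

end KahanLaw

end Summit.Ventures.CertifiedArithmetic.LowPrec.SR
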